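import Mathlib.Analysis.SpecialFunctions.Pow.Deriv
import Literature.NumberTheory.GaloisRepresentations.HeckeCharacter
import Literature.NumberTheory.GaloisRepresentations.ArtinLFunctionContinuationFE
import HarnessLib

/-!
# Archimedean `Γ`-factors of Hecke type have entire inverses; `Λ` entire `⇒` `L` entire

Sibling proof file of `Literature/NumberTheory/GaloisRepresentations/HeckeCharacter.lean`, a step
towards its named fact `heckeLFunction_hasEntireContinuation_of_not_isNormTwist` (Hecke's
theorem: `L(χ, s)` is entire for a unitary Hecke character `χ` which is not a norm twist; Tate
(1950), Thm. 4.4.1 with §4.5; Neukirch, *Algebraic Number Theory*, VII (8.5)–(8.6)).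

Both printed proofs deliver the entire function upstairs, for the **completed** L-function:
Neukirch VII (8.5) "`Λ(𝔎, χ, s) = (|d_K| 𝔑(𝔪))^{s/2} L_∞(χ, s) L(𝔎, χ, s)` … is holomorphic on all of
`ℂ`, if `𝔪 ≠ 1` or `p ≠ 0`", with `L_∞(χ, s) = ∏_𝔭 L_𝔭(χ, s)` a product of the factors
`Γ_ℝ(s + ·)`, `Γ_ℂ(s + ·)` of VII (8.3)–(8.4); Tate §4.5 (Cassels–Fröhlich p. 345–346)
"`ζ(f, c‖·‖^s) = ∏_{𝔭 ∈ S} ζ_𝔭(f_𝔭, c_𝔭‖·‖_𝔭^s) · ∏_{𝔭 ∉ S} 𝔑𝔡_𝔭^{-1/2} · ζ(s, χ)`", the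
archimedean `ζ_𝔭` being the `Γ`-factors of §2.5.  The descent to `L(χ, s)` itself — the
statement of the named fact — divides by the `Γ`-factor, whose inverse is entire (`1/Γ` is
entire) and which has no zero on `re s > 1`.  This file PROVES that descent in the vocabulary of
`HeckeCharacter.lean` (`HeckeCharacter.archGammaFactor a s = ∏_{w real} Γ_ℝ(s + a_w) ·
∏_{w complex} Γ_ℂ(s + a_w)`, the `Γ`-factor of the named fact `heckeLFunction_functional_equation`):

* `differentiable_Gammaℂ_inv` — `1/Γ_ℂ` is entire (from Mathlib's `1/Γ_ℝ` through
  `Γ_ℝ(s) Γ_ℝ(s + 1) = Γ_ℂ(s)`; the tree's `Complex.Gammaℂ_ne_zero_of_re_pos` of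
  `ArtinLFunctionContinuationFE` — the Artin-representation analogue of this file — gives
  `Γ_ℂ(s) ≠ 0` for `re s > 0`);
* `HeckeCharacter.differentiable_archGammaFactor_inv` — `s ↦ γ_a(s)⁻¹` is entire, for all shifts;
* `HeckeCharacter.archGammaFactor_ne_zero` — `γ_a(s) ≠ 0` if `re (s + a_w) > 0` for all `w`; in
  particular on `re s > 1` when `re a_w ≥ 0` (the shifts `δ + iφ`, `|k|/2 + iφ` of a unitary
  character, Neukirch VII (8.3); Tate §2.5);
* `hasEntireContinuation_heckeLFunction_of_completed` — **`Λ` entire `⇒` `L(χ, ·)` entire**: if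
  some entire `Λ` agrees with `A^{s/2} γ_a(s) L(χ, s)` on `re s > 1` (`A > 0`, `re a_w ≥ 0`), then
  `heckeLFunction χ` has an entire continuation (`LFunction.HasEntireContinuation`), namely
  `Λ(s) A^{-s/2} γ_a(s)⁻¹`; and the abstract form `LFunction.hasEntireContinuation_of_mul_eq`.

No named fact is introduced.

## References

* J. Tate, *Fourier analysis in number fields and Hecke's zeta-functions* (1950), in
  Cassels–Fröhlich, *Algebraic Number Theory* (1967), Ch. XV, §2.5 and §4.5 (p. 345–346).
  [TateThesis1967]
* J. Neukirch, *Algebraic Number Theory* (1999), Ch. VII (8.3)–(8.6). [NeukirchANT1999]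

## Mathlib

`Complex.differentiable_Gammaℝ_inv`, `Complex.Gammaℝ_ne_zero_of_re_pos`,
`Complex.Gammaℝ_mul_Gammaℝ_add_one` (`Analysis/SpecialFunctions/Gamma/Deligne`),
`Differentiable.const_cpow`, `Differentiable.fun_finsetProd`; and from the tree
`Complex.Gammaℂ_ne_zero_of_re_pos` (`ArtinLFunctionContinuationFE`, whose
`exists_differentiable_mul_gammaFactor_eq_one` is the same descent for Artin `Γ`-factors).
-/

noncomputable section

open NumberField Complex

namespace Literature.NumberTheory.GaloisRepresentations

/-! ### `Γ_ℂ` -/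

/-- `1 / Γ_ℂ` is entire (`Γ_ℂ(s) = Γ_ℝ(s) Γ_ℝ(s + 1)` and `1 / Γ_ℝ` is entire, Mathlib
`Complex.differentiable_Gammaℝ_inv`). [folklore] -/
theorem differentiable_Gammaℂ_inv : Differentiable ℂ fun s : ℂ => (Gammaℂ s)⁻¹ := by
  have h : (fun s : ℂ => (Gammaℂ s)⁻¹) = fun s => (Gammaℝ s)⁻¹ * (Gammaℝ (s + 1))⁻¹ := by
    funext s
    rw [← Gammaℝ_mul_Gammaℝ_add_one, mul_inv]
  rw [h]
  exact differentiable_Gammaℝ_inv.mul (differentiable_Gammaℝ_inv.comp (differentiable_id.add_const 1))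

/-! ### The `Γ`-factor `γ_a` of `HeckeCharacter.lean` -/

namespace HeckeCharacter

universe u

variable {K : Type u} [Field K] [NumberField K]

/-- **The inverse `Γ`-factor is entire**: for every family of shifts `a`,
`s ↦ γ_a(s)⁻¹ = ∏_{w real} Γ_ℝ(s + a_w)⁻¹ ∏_{w complex} Γ_ℂ(s + a_w)⁻¹` is differentiable on `ℂ`.
[cite: NeukirchANT1999, VII (8.3)–(8.5)] -/
theorem differentiable_archGammaFactor_inv (a : InfinitePlace K → ℂ) :
    Differentiable ℂ fun s : ℂ => (archGammaFactor a s)⁻¹ := by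
  classical
  have h : (fun s : ℂ => (archGammaFactor a s)⁻¹) = fun s => ∏ w : InfinitePlace K,
      (if w.IsReal then (Gammaℝ (s + a w))⁻¹ else (Gammaℂ (s + a w))⁻¹) := by
    funext s
    rw [archGammaFactor, ← Finset.prod_inv_distrib]
    refine Finset.prod_congr rfl fun w _ => ?_
    split_ifs <;> rfl
  rw [h]
  refine Differentiable.fun_finsetProd fun w _ => ?_
  split_ifs
  · exact differentiable_Gammaℝ_inv.comp (differentiable_id.add_const _)
  · exact differentiable_Gammaℂ_inv.comp (differentiable_id.add_const _)

/-- **The `Γ`-factor has no zeros to the right**: `γ_a(s) ≠ 0` as soon as `re (s + a_w) > 0`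
for every archimedean place `w`. [cite: NeukirchANT1999, VII (8.3)–(8.5)] -/
theorem archGammaFactor_ne_zero_of_re_add_pos (a : InfinitePlace K → ℂ) {s : ℂ}
    (hs : ∀ w, 0 < (s + a w).re) : archGammaFactor a s ≠ 0 := by
  classical
  rw [archGammaFactor]
  refine Finset.prod_ne_zero_iff.mpr fun w _ => ?_
  split_ifs
  · exact Gammaℝ_ne_zero_of_re_pos (hs w)
  · exact Gammaℂ_ne_zero_of_re_pos (hs w)

/-- In particular `γ_a(s) ≠ 0` for `re s > 0` when all shifts have `re a_w ≥ 0` — the case of the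
shifts `δ + iφ` (`δ ∈ {0, 1}`) and `|k|/2 + iφ` of a unitary Hecke character (Neukirch VII
(8.3); Tate (1950), §2.5). [cite: NeukirchANT1999, VII (8.3)] -/
theorem archGammaFactor_ne_zero (a : InfinitePlace K → ℂ) (ha : ∀ w, 0 ≤ (a w).re) {s : ℂ}
    (hs : 0 < s.re) : archGammaFactor a s ≠ 0 :=
  archGammaFactor_ne_zero_of_re_add_pos a fun w => by
    rw [add_re]
    linarith [ha w]

end HeckeCharacter

/-! ### `Λ` entire `⇒` `L` entire -/

/-- Abstract descent: if `Λ` is entire, `B` is entire, and `f = Λ · B` on `re s > 1`, then `f`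
has an entire continuation (namely `Λ · B`). [folklore] -/
theorem LFunction.hasEntireContinuation_of_mul_eq {f Λ B : ℂ → ℂ} (hΛ : Differentiable ℂ Λ)
    (hB : Differentiable ℂ B) (h : ∀ s : ℂ, 1 < s.re → Λ s * B s = f s) :
    LFunction.HasEntireContinuation f :=
  ⟨fun s => Λ s * B s, hΛ.mul hB, h⟩

section Completed

universe u

variable {K : Type u} [Field K] [NumberField K]

/-- **`Λ(χ, ·)` entire `⇒` `L(χ, ·)` entire** (the last step of Neukirch VII (8.5)–(8.6) and of
Tate (1950), §4.5, in the vocabulary of `HeckeCharacter.lean`): if an entire `Λ` satisfies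
`Λ(s) = A^{s/2} γ_a(s) L(χ, s)` for `re s > 1`, with `A > 0` and shifts of non-negative real
part, then `heckeLFunction χ` has an entire continuation, namely `s ↦ Λ(s) A^{-s/2} γ_a(s)⁻¹`
(`A^{-s/2}` and `γ_a⁻¹` are entire, and `A^{s/2} γ_a(s) ≠ 0` on `re s > 1`).
[cite: NeukirchANT1999, VII (8.5)–(8.6)] [cite: TateThesis1967, §4.5] -/
theorem hasEntireContinuation_heckeLFunction_of_completed (χ : HeckeCharacter K) {A : ℝ}
    (hA : 0 < A) {a : InfinitePlace K → ℂ} (ha : ∀ w, 0 ≤ (a w).re) {Λ : ℂ → ℂ}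
    (hΛ : Differentiable ℂ Λ)
    (hagree : ∀ s : ℂ, 1 < s.re →
      Λ s = (A : ℂ) ^ (s / 2) * HeckeCharacter.archGammaFactor a s * heckeLFunction χ s) :
    LFunction.HasEntireContinuation (heckeLFunction χ) := by
  have hA0 : (A : ℂ) ≠ 0 := ofReal_ne_zero.mpr hA.ne'
  refine LFunction.hasEntireContinuation_of_mul_eq hΛ
    (B := fun s => (A : ℂ) ^ (-(s / 2)) * (HeckeCharacter.archGammaFactor a s)⁻¹) ?_ fun s hs => ?_
  · exact (((differentiable_id.div_const 2).neg).const_cpow (Or.inl hA0)).mul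
      (HeckeCharacter.differentiable_archGammaFactor_inv a)
  · have hγ : HeckeCharacter.archGammaFactor a s ≠ 0 :=
      HeckeCharacter.archGammaFactor_ne_zero a ha (by linarith)
    have hAs : (A : ℂ) ^ (s / 2) ≠ 0 := fun h => hA0 ((cpow_eq_zero_iff _ _).mp h).1
    rw [hagree s hs, cpow_neg]
    field_simp

end Completed

end Literature.NumberTheory.GaloisRepresentations
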